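import Summits.QuantumFields.YangMills.Theorems.UnitScaleGibbsOneBondSchwingerDyson
import Summits.QuantumFields.YangMills.Theorems.CovariantDischargeHaarSweepReweighting
import HarnessLib

/-!
# The one-bond Haar shift ∕ Schwinger–Dyson identity with an ADAPTED direction — RIGHT-SHIFT TWIN `U ↦ U[b ↦ U_b·k U t]`
# ((SD-R)(i) of LINE 28 «gross-sd-transfer», construction C3 in the RIGHT chart `Node00.expChart`; crux `HistoryTailL`, stmt-QuantumFields-19936)

Cell `ym3-torus` (YM ladder rung R3 = continuum SU(2) Yang–Mills on T³ — a RUNG, NOT the Clay problem: not d = 4, not infinite volume, not a mass gap);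
WIDTH helper seat `ym3-torus-px8` g9.  Helper `--supports stmt-QuantumFields-19936`; THEOREMS ONLY (0 `def`, 0 `sorry`, default heartbeats).  The twin of
✓`UnitScaleGibbsOneBondSchwingerDysonAdapted` ((SD-AD), ✓p735641) with RIGHT translations: the skew-translation letters of ✓`CovariantDischargeHaarSweepReweighting`
(`measurePreserving_update_mul_right`, `measurable_update_mul_(inv_)right`, `leftInverse_update_mul_(inv_)right`, `integral_comp_gibbsMeasure`) and D1's bounded-Lipschitz
engine are used BY NAME.

WHY (px17 g7 18:08:02Z LOCATE «LEFT vs RIGHT», px10 g7 ∕ px5 g10 concurring).  In C3 the natural Schwinger–Dyson flow of a non-tree bond `b` is the RIGHT shift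
`U_b ↦ U_b·e^{t·Ad(g_{y_b}(U)⁻¹)u⁰_b}` (direction a function of the TREE bonds, hence adapted): it moves the axial representative `V` by `V_b ↦ V_b·e^{t u⁰_b} =
Node00.expChart V (t•u⁰)` EXACTLY, the chart in which ✓`UnitScaleGibbsOnEventHessianAxialGauge` (px10, `stub_hessOnEvent` shape) and ✓`UnitScaleGibbsFirstVariationFluxPairing`
(X-KNIT) are written.  This file: `update_adapted_flow_right` ∕ `update_adapted_zero_right`; ★`integral_comp_update_mul_right_fieldMeasure_adapted`;
`integral_shiftDeriv_eq_zero_fieldMeasure_adapted_right`; ★★`integral_comp_update_mul_right_gibbsMeasure_adapted`; ★★★`integral_shiftDeriv_eq_gibbsMeasure_adapted_right`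
(`∫ f′ dμ_β = β·∫ f·A′ dμ_β` along `t ↦ U[b ↦ U_b·k U t]`); ★`integral_shiftDeriv_eq_gibbsMeasure_right` (the constant-direction right twin of D1).  The right-chart one-bond
derivative ROWS of `A_W` ((SD-R)(ii)) are px17 g7's pen and are NOT here.
HONEST SCOPE.  Exact finite-`β` identities (infrastructure); nothing of `stub_condSD` ∕ C3's Hessian rows ∕ «ShallowFluxSecondMomentL» ∕ (Q) ∕ K1 ∕ `MeanDeviationL` ∕ `HistoryTailL`,
of the rung R3, d = 4, a continuum limit or a mass gap is proved here; the Yang–Mills mass gap is NOT proved.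

References: M. Creutz, Quarks, Gluons and Lattices (1983∕2022) Ch. 11 [Creutz2022]; L. Gross, CMP 92 (1983) 137–162, Lemma 4.1 ∕ Thm 2.2 [GrossCMP1983].
-/

noncomputable section

open MeasureTheory Filter Topology
open Literature.MathematicalPhysics.QuantumFieldTheory.Balaban1983to89
open Literature.MathematicalPhysics.QuantumFieldTheory.Balaban1983to89.Missing
  (boltzmann partitionFn boltzmann_pos partitionFn_pos' measurable_wilsonAction4 isProbabilityMeasure_fieldMeasure)
open Literature.MathematicalPhysics.QuantumFieldTheory.Balaban1983to89.T4GenFunBounds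
  (gibbsMeasure integral_gibbsMeasure isProbabilityMeasure_gibbsMeasure)
open Summit.QuantumFields.YangMills.Theorems.EquipartitionPinsProbe.TangentSteinFiniteBeta
  (lipschitz_of_flow abs_exp_sub_exp_le)
open Summit.QuantumFields.YangMills.Theorems.EquipartitionPinsProbe.TangentDiffIdentity
  (hasDerivAt_integral_of_bounded_lipschitz)
open Summit.QuantumFields.YangMills.Theorems.UnitScaleGibbsOneBondSchwingerDyson
  (abs_wilsonAction4_le)
open Summit.QuantumFields.YangMills.Theorems.CovariantDischargeHaarSweepReweighting
  (measurePreserving_update_mul_right measurable_update_mul_right measurable_update_mul_inv_right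
    leftInverse_update_mul_inv_right leftInverse_update_mul_right integral_comp_gibbsMeasure)

namespace Summit.QuantumFields.YangMills.Theorems.UnitScaleGibbsOneBondSchwingerDysonAdaptedRight

variable {P : Params} {G : Type} [GaugeGroup G]

section General

variable {j : ℕ} [DecidableEq (PBond P j)]

/-! ## §1 Adapted one-bond RIGHT shifts `U ↦ U[b ↦ U_b·g(U)]` -/

/-- Along an ADAPTED multiplicative family `k U (s+t) = k U s · k U t`, `k (U[b ↦ x]) = k U`, the RIGHT shifts `U ↦ U[b ↦ U_b·k U t]` compose:
`T_{t+s} = T_t ∘ T_s` (on the right the factors appear in the order `k U s · k U t`). [cite: Creutz2022, Ch. 11] -/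
theorem update_adapted_flow_right (b : PBond P j) {k : GaugeField P j G → ℝ → G}
    (hk : ∀ (U : GaugeField P j G) (s t : ℝ), k U (s + t) = k U s * k U t)
    (hkb : ∀ (U : GaugeField P j G) (x : G), k (Function.update U b x) = k U) (s t : ℝ) (U : GaugeField P j G) :
    Function.update U b (U b * k U (t + s)) =
      Function.update (Function.update U b (U b * k U s)) b
        (Function.update U b (U b * k U s) b * k (Function.update U b (U b * k U s)) t) := by
  rw [hkb]
  funext b'
  by_cases hb : b' = b
  · subst hb; simp [add_comm t s, hk U s t, mul_assoc]
  · simp [hb]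

/-- An adapted multiplicative family starts at `1`, so the right shift `T_0 = id`. [cite: Creutz2022, Ch. 11] -/
theorem update_adapted_zero_right (b : PBond P j) {k : GaugeField P j G → ℝ → G}
    (hk : ∀ (U : GaugeField P j G) (s t : ℝ), k U (s + t) = k U s * k U t) (U : GaugeField P j G) :
    Function.update U b (U b * k U 0) = U := by
  have h1 : k U 0 = 1 := by
    have h := hk U 0 0
    rw [add_zero] at h
    exact mul_eq_left.1 h.symm
  rw [h1, mul_one, Function.update_eq_self]

variable [MeasurableSpace G] [RegularGaugeGroup G]

variable [HaarData G]

/-- ★ **CHANGE OF VARIABLES (right shift)**: `∫ f(U[b ↦ U_b·g(U)]) dU = ∫ f dU` for adapted measurable `g` and every `f` (the tree's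
`measurePreserving_update_mul_right` packaged as a measurable equivalence with inverse the right `g(U)⁻¹`-shift). [cite: Creutz2022, Ch. 11] -/
theorem integral_comp_update_mul_right_fieldMeasure_adapted (b : PBond P j) {g : GaugeField P j G → G} (hgm : Measurable g)
    (hgb : ∀ (U : GaugeField P j G) (x : G), g (Function.update U b x) = g U) (f : GaugeField P j G → ℝ) :
    ∫ U, f (Function.update U b (U b * g U)) ∂fieldMeasure P j G = ∫ U, f U ∂fieldMeasure P j G := by
  let T : GaugeField P j G ≃ᵐ GaugeField P j G :=
    { toFun := fun U => Function.update U b (U b * g U)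
      invFun := fun U => Function.update U b (U b * (g U)⁻¹)
      left_inv := leftInverse_update_mul_inv_right b hgb
      right_inv := leftInverse_update_mul_right b hgb
      measurable_toFun := measurable_update_mul_right b hgm
      measurable_invFun := measurable_update_mul_inv_right b hgm }
  have hT : MeasurePreserving T (fieldMeasure P j G) (fieldMeasure P j G) := measurePreserving_update_mul_right b hgm hgb
  exact hT.integral_comp' f

/-- **HAAR CASE (right shift)**: `∫ f′ dU = 0` for the derivative `f′` of a bounded measurable `f` along an adapted multiplicative RIGHT shift family.
[cite: GrossCMP1983, Lemma 4.1] -/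
theorem integral_shiftDeriv_eq_zero_fieldMeasure_adapted_right (b : PBond P j) {k : GaugeField P j G → ℝ → G}
    (hk : ∀ (U : GaugeField P j G) (s t : ℝ), k U (s + t) = k U s * k U t)
    (hkb : ∀ (U : GaugeField P j G) (x : G), k (Function.update U b x) = k U) (hkm : ∀ t, Measurable fun U => k U t)
    (f f' : GaugeField P j G → ℝ) (hfm : Measurable f) (hf'm : Measurable f') {Cf Cf' : ℝ} (hCf : ∀ U, |f U| ≤ Cf)
    (hCf' : ∀ U, |f' U| ≤ Cf') (hf' : ∀ U, HasDerivAt (fun t => f (Function.update U b (U b * k U t))) (f' U) 0) :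
    ∫ U, f' U ∂fieldMeasure P j G = 0 := by
  haveI := isProbabilityMeasure_fieldMeasure (G := G) P j
  set μ := fieldMeasure P j G with hμ
  set T : ℝ → GaugeField P j G → GaugeField P j G := fun t U => Function.update U b (U b * k U t) with hT
  have hflow : ∀ s t U, T (t + s) U = T t (T s U) := fun s t U => update_adapted_flow_right b hk hkb s t U
  have hTm : ∀ t, Measurable (T t) := fun t => measurable_update_mul_right b (hkm t)
  have hf'T : ∀ U, HasDerivAt (fun t => f (T t U)) (f' U) 0 := hf'
  have hAB : ∀ t : ℝ, ∫ U, f (T t U) ∂μ = ∫ U, f U ∂μ := fun t =>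
    integral_comp_update_mul_right_fieldMeasure_adapted b (hkm t) (fun U x => by simp only [hkb]) f
  have hAd : HasDerivAt (fun t : ℝ => ∫ U, f (T t U) ∂μ) (∫ U, f' U ∂μ) 0 := by
    refine hasDerivAt_integral_of_bounded_lipschitz μ (fun t U => f (T t U)) f' (Cf + Cf')
      (fun t => hfm.comp (hTm t)) hf'm
      (fun t U => (hCf _).trans (le_add_of_nonneg_right ?_)) (fun U t s => ?_) hf'T
    · exact (abs_nonneg _).trans (hCf' U)
    · calc |f (T t U) - f (T s U)| ≤ Cf' * |t - s| := lipschitz_of_flow T hflow f f' hf'T hCf' U t s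
        _ ≤ (Cf + Cf') * |t - s| := by
            gcongr; linarith [(abs_nonneg _).trans (hCf U)]
  have hEq : (fun t : ℝ => ∫ U, f (T t U) ∂μ) = fun _ : ℝ => ∫ U, f U ∂μ := funext hAB
  rw [hEq] at hAd
  exact hAd.unique (hasDerivAt_const (0 : ℝ) _)

end General

section Finest

variable [DecidableEq (PBond P 0)] [MeasurableSpace G] [RegularGaugeGroup G] [HaarData G]

/-! ## §2 The adapted one-bond right Haar-shift (Gibbs ∕ DLR) identity -/

/-- ★★ **THE ADAPTED ONE-BOND RIGHT HAAR-SHIFT IDENTITY OF BAŁABAN'S GIBBS MEASURE** (`β ≥ 0`; `g` measurable, adapted to the bonds `≠ b`):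
`∫ f(U[b ↦ U_b·g(U)]) dμ_β = ∫ f(U)·exp(−β(A(U[b ↦ U_b·g(U)⁻¹]) − A(U))) dμ_β` — the sweep engine's `integral_comp_gibbsMeasure` at the adapted right shift.
[cite: Creutz2022, Ch. 11] -/
theorem integral_comp_update_mul_right_gibbsMeasure_adapted {β : ℝ} (hβ : 0 ≤ β) (b : PBond P 0) {g : GaugeField P 0 G → G}
    (hgm : Measurable g) (hgb : ∀ (U : GaugeField P 0 G) (x : G), g (Function.update U b x) = g U)
    (f : GaugeField P 0 G → ℝ) :
    ∫ U, f (Function.update U b (U b * g U)) ∂gibbsMeasure P β =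
      ∫ U, f U * Real.exp (-(β * (wilsonAction4 (Function.update U b (U b * (g U)⁻¹)) - wilsonAction4 U)))
        ∂gibbsMeasure P β :=
  integral_comp_gibbsMeasure hβ (measurePreserving_update_mul_right b hgm hgb) (measurable_update_mul_inv_right b hgm)
    (leftInverse_update_mul_inv_right b hgb) (leftInverse_update_mul_right b hgb) f

/-! ## §3 The adapted one-bond Schwinger–Dyson identity, right shift -/

/-- ★★★ **THE ONE-BOND SCHWINGER–DYSON IDENTITY WITH AN ADAPTED DIRECTION, RIGHT SHIFT `U ↦ U[b ↦ U_b·k U t]`.**  Let `β ≥ 0`, `b` a finest bond, and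
`k : GaugeField P 0 G → ℝ → G` an ADAPTED multiplicative family (`k U (s+t) = k U s · k U t`, `k (U[b ↦ x]) = k U`, `U ↦ k U t` measurable;
e.g. `k U t = exp(t·w(U))` with `w` a function of the bonds `≠ b`; in C3, `w(U) = Ad(g_{x_b}(U)⁻¹)u⁰_b` where the tree-gauge transporter
`g_{x_b}(U)` reads only TREE-bond variables and `b` is a NON-tree bond, so `hkb` is discharged by `Function.update_of_ne` on every tree bond).
If `f` is measurable and bounded with a measurable bounded derivative
`f′` along `t ↦ U[b ↦ U_b · k U t]` at `t = 0` (the RIGHT chart — `Node00.expChart` of the dressed field in C3, px17 g7's 18:08:02Z seam), and `A′` is such a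
derivative of `A = wilsonAction4`, then `∫ f′ dμ_β = β·∫ f·A′ dμ_β`.  The (SD-AD) proof verbatim with the right-shift flow. [cite: GrossCMP1983, Lemma 4.1; Creutz2022, Ch. 11] -/
theorem integral_shiftDeriv_eq_gibbsMeasure_adapted_right {β : ℝ} (hβ : 0 ≤ β) (b : PBond P 0) {k : GaugeField P 0 G → ℝ → G}
    (hk : ∀ (U : GaugeField P 0 G) (s t : ℝ), k U (s + t) = k U s * k U t)
    (hkb : ∀ (U : GaugeField P 0 G) (x : G), k (Function.update U b x) = k U) (hkm : ∀ t, Measurable fun U => k U t)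
    (f f' : GaugeField P 0 G → ℝ) (hfm : Measurable f) (hf'm : Measurable f')
    {Cf Cf' : ℝ} (hCf : ∀ U, |f U| ≤ Cf) (hCf' : ∀ U, |f' U| ≤ Cf')
    (hf' : ∀ U, HasDerivAt (fun t => f (Function.update U b (U b * k U t))) (f' U) 0)
    (A' : GaugeField P 0 G → ℝ) (hA'm : Measurable A') {CA' : ℝ} (hCA' : ∀ U, |A' U| ≤ CA')
    (hA' : ∀ U, HasDerivAt (fun t => wilsonAction4 (Function.update U b (U b * k U t))) (A' U) 0) :
    ∫ U, f' U ∂gibbsMeasure P β = β * ∫ U, f U * A' U ∂gibbsMeasure P β := by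
  haveI := isProbabilityMeasure_gibbsMeasure (G := G) P hβ
  set μ := gibbsMeasure (G := G) P β with hμ
  set S : GaugeField P 0 G → ℝ := fun U => wilsonAction4 U with hSdef
  set T : ℝ → GaugeField P 0 G → GaugeField P 0 G := fun t U => Function.update U b (U b * k U t) with hT
  have hflow : ∀ s t U, T (t + s) U = T t (T s U) := fun s t U => update_adapted_flow_right b hk hkb s t U
  have hT0 : ∀ U, T 0 U = U := fun U => update_adapted_zero_right b hk U
  have hTm : ∀ t, Measurable (T t) := fun t => measurable_update_mul_right b (hkm t)
  have hf'T : ∀ U, HasDerivAt (fun t => f (T t U)) (f' U) 0 := hf'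
  have hS'T : ∀ U, HasDerivAt (fun t => S (T t U)) (A' U) 0 := hA'
  have hCf0 : 0 ≤ Cf := (abs_nonneg _).trans (hCf (fun _ => 1))
  have hSm : Measurable S := measurable_wilsonAction4 RegularGaugeGroup.measurable_reTr
  set CS : ℝ := 2 * (Fintype.card (Plaq P 0) : ℝ) with hCSdef
  have hCS : ∀ U, |S U| ≤ CS := fun U => abs_wilsonAction4_le U
  -- `k U (-t) = (k U t)⁻¹`
  have hkinv : ∀ (U : GaugeField P 0 G) (t : ℝ), (k U t)⁻¹ = k U (-t) := fun U t => by
    have h0 : k U 0 = 1 := by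
      have h' := hk U 0 0
      rw [add_zero] at h'
      exact mul_eq_left.1 h'.symm
    have h1 : k U (-t) * k U t = 1 := by rw [← hk, neg_add_cancel, h0]
    exact inv_eq_of_mul_eq_one_left h1
  -- the two sides of the finite-shift identity, as functions of `t`
  have hAB : ∀ t : ℝ, ∫ U, f (T t U) ∂μ = ∫ U, f U * Real.exp (-(β * (S (T (-t) U) - S U))) ∂μ := by
    intro t
    have h := integral_comp_update_mul_right_gibbsMeasure_adapted (P := P) hβ b (hkm t) (fun U x => by simp only [hkb]) f
    simp only [hkinv] at h
    exact h
  -- derivative of the left side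
  have hAd : HasDerivAt (fun t : ℝ => ∫ U, f (T t U) ∂μ) (∫ U, f' U ∂μ) 0 := by
    refine hasDerivAt_integral_of_bounded_lipschitz μ (fun t U => f (T t U)) f' (Cf + Cf')
      (fun t => hfm.comp (hTm t)) hf'm
      (fun t U => (hCf _).trans (le_add_of_nonneg_right ?_)) (fun U t s => ?_) hf'T
    · exact (abs_nonneg _).trans (hCf' U)
    · calc |f (T t U) - f (T s U)| ≤ Cf' * |t - s| := lipschitz_of_flow T hflow f f' hf'T hCf' U t s
        _ ≤ (Cf + Cf') * |t - s| := by gcongr; linarith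
  -- derivative of the right side
  have hBd : HasDerivAt (fun t : ℝ => ∫ U, f U * Real.exp (-(β * (S (T (-t) U) - S U))) ∂μ)
      (∫ U, f U * (β * A' U) ∂μ) 0 := by
    set M := |β| * (2 * CS) with hMdef
    have hM : ∀ t U, -(β * (S (T (-t) U) - S U)) ≤ M := fun t U => by
      have h1 := hCS (T (-t) U)
      have h2 := hCS U
      calc -(β * (S (T (-t) U) - S U)) ≤ |β * (S (T (-t) U) - S U)| := neg_le_abs _
        _ = |β| * |S (T (-t) U) - S U| := abs_mul _ _
        _ ≤ |β| * (2 * CS) := by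
            gcongr
            calc |S (T (-t) U) - S U| ≤ |S (T (-t) U)| + |S U| := abs_sub _ _
              _ ≤ CS + CS := add_le_add h1 h2
              _ = 2 * CS := by ring
    have hE : ∀ t U, |Real.exp (-(β * (S (T (-t) U) - S U)))| ≤ Real.exp M := fun t U => by
      rw [abs_of_pos (Real.exp_pos _)]
      exact Real.exp_le_exp.2 (hM t U)
    have hSlip : ∀ U t s, |S (T (-t) U) - S (T (-s) U)| ≤ CA' * |t - s| := fun U t s => by
      have h := lipschitz_of_flow T hflow S A' hS'T hCA' U (-t) (-s)
      rwa [show |(-t) - (-s)| = |t - s| by rw [neg_sub_neg, abs_sub_comm]] at h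
    refine hasDerivAt_integral_of_bounded_lipschitz μ
      (fun t U => f U * Real.exp (-(β * (S (T (-t) U) - S U)))) (fun U => f U * (β * A' U))
      (Cf * Real.exp M + Cf * (Real.exp M * (|β| * CA'))) (fun t => ?_) ?_ (fun t U => ?_)
      (fun U t s => ?_) (fun U => ?_)
    · exact hfm.mul (((((hSm.comp (hTm (-t))).sub hSm).const_mul β).neg).exp)
    · exact hfm.mul (hA'm.const_mul β)
    · calc |f U * Real.exp (-(β * (S (T (-t) U) - S U)))|
          = |f U| * |Real.exp (-(β * (S (T (-t) U) - S U)))| := abs_mul _ _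
        _ ≤ Cf * Real.exp M := mul_le_mul (hCf U) (hE t U) (abs_nonneg _) hCf0
        _ ≤ Cf * Real.exp M + Cf * (Real.exp M * (|β| * CA')) := le_add_of_nonneg_right (by
            have : 0 ≤ CA' := (abs_nonneg _).trans (hCA' U)
            positivity)
    · have hx : -(β * (S (T (-t) U) - S U)) ≤ M := hM t U
      have hy : -(β * (S (T (-s) U) - S U)) ≤ M := hM s U
      have hCA'0 : 0 ≤ CA' := (abs_nonneg _).trans (hCA' U)
      calc |f U * Real.exp (-(β * (S (T (-t) U) - S U))) - f U * Real.exp (-(β * (S (T (-s) U) - S U)))|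
          = |f U| * |Real.exp (-(β * (S (T (-t) U) - S U))) - Real.exp (-(β * (S (T (-s) U) - S U)))| := by
            rw [← mul_sub, abs_mul]
        _ ≤ Cf * (Real.exp M * |(-(β * (S (T (-t) U) - S U))) - (-(β * (S (T (-s) U) - S U)))|) :=
            mul_le_mul (hCf U) (abs_exp_sub_exp_le hx hy) (abs_nonneg _) hCf0
        _ = Cf * (Real.exp M * (|β| * |S (T (-t) U) - S (T (-s) U)|)) := by
            rw [show -(β * (S (T (-t) U) - S U)) - -(β * (S (T (-s) U) - S U)) =
              -(β * (S (T (-t) U) - S (T (-s) U))) by ring, abs_neg, abs_mul]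
        _ ≤ Cf * (Real.exp M * (|β| * (CA' * |t - s|))) := by gcongr; exact hSlip U t s
        _ = Cf * (Real.exp M * (|β| * CA')) * |t - s| := by ring
        _ ≤ (Cf * Real.exp M + Cf * (Real.exp M * (|β| * CA'))) * |t - s| := by
            have : 0 ≤ Cf * Real.exp M * |t - s| := by positivity
            nlinarith [this]
    · have hSneg : HasDerivAt (fun t : ℝ => S (T (-t) U)) (-(A' U)) 0 := by
        have h0 : HasDerivAt (fun t : ℝ => S (T t U)) (A' U) (-0) := by rw [neg_zero]; exact hS'T U
        have h := h0.scomp (0 : ℝ) (hasDerivAt_neg (0 : ℝ))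
        simpa [Function.comp_def] using h
      have hin : HasDerivAt (fun t : ℝ => -(β * (S (T (-t) U) - S U))) (β * A' U) 0 := by
        exact (((hSneg.sub_const (S U)).const_mul β).neg).congr_deriv (by ring)
      have hexp := hin.exp
      have h0 : -(β * (S (T (-0) U) - S U)) = 0 := by rw [neg_zero, hT0, sub_self, mul_zero, neg_zero]
      rw [h0, Real.exp_zero, one_mul] at hexp
      exact hexp.const_mul (f U)
  have hEq : (fun t : ℝ => ∫ U, f (T t U) ∂μ) =
      fun t : ℝ => ∫ U, f U * Real.exp (-(β * (S (T (-t) U) - S U))) ∂μ := funext hAB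
  rw [hEq] at hAd
  rw [hAd.unique hBd, ← integral_const_mul]
  refine integral_congr_ae (ae_of_all _ fun U => ?_)
  ring

/-- ★ **THE CONSTANT-DIRECTION RIGHT TWIN OF D1** (`k U := k₀`): `∫ f′ dμ_β = β·∫ f·A′ dμ_β` along `t ↦ U[b ↦ U_b · k₀ t]` for a multiplicative `k₀ : ℝ → G`
(e.g. `t ↦ exp(t·X)`) — ✓p730664 `integral_shiftDeriv_eq_gibbsMeasure` read in the right chart. [cite: GrossCMP1983, Lemma 4.1; Creutz2022, Ch. 11] -/
theorem integral_shiftDeriv_eq_gibbsMeasure_right {β : ℝ} (hβ : 0 ≤ β) (b : PBond P 0) {k₀ : ℝ → G}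
    (hk : ∀ s t : ℝ, k₀ (s + t) = k₀ s * k₀ t)
    (f f' : GaugeField P 0 G → ℝ) (hfm : Measurable f) (hf'm : Measurable f')
    {Cf Cf' : ℝ} (hCf : ∀ U, |f U| ≤ Cf) (hCf' : ∀ U, |f' U| ≤ Cf')
    (hf' : ∀ U, HasDerivAt (fun t => f (Function.update U b (U b * k₀ t))) (f' U) 0)
    (A' : GaugeField P 0 G → ℝ) (hA'm : Measurable A') {CA' : ℝ} (hCA' : ∀ U, |A' U| ≤ CA')
    (hA' : ∀ U, HasDerivAt (fun t => wilsonAction4 (Function.update U b (U b * k₀ t))) (A' U) 0) :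
    ∫ U, f' U ∂gibbsMeasure P β = β * ∫ U, f U * A' U ∂gibbsMeasure P β :=
  integral_shiftDeriv_eq_gibbsMeasure_adapted_right hβ b (k := fun _ => k₀) (fun _ s t => hk s t) (fun _ _ => rfl)
    (fun _ => measurable_const) f f' hfm hf'm hCf hCf' hf' A' hA'm hCA' hA'

end Finest

end Summit.QuantumFields.YangMills.Theorems.UnitScaleGibbsOneBondSchwingerDysonAdaptedRight

end
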